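import Mathlib
import HarnessLib

/-!
# Colengths as `κ`-dimensions: monotonicity, strictness and two exact-sequence bounds

`Literature/RingTheory/Length/ColengthFinrank.lean`. For a commutative algebra `A` over a field `κ`
and ideals of FINITE COLENGTH (the quotient `A ⧸ I` finite-dimensional over `κ`), the colength
`dim_κ (A ⧸ I)` behaves like a length: it is monotone and strictly monotone in `I`
(`finrank_quotient_add_finrank_map`, `finrank_quotient_le_of_le`, `finrank_quotient_lt_of_lt`), it is
sub-additive along the right-exact sequence `A/(K + (g)) —·x→ A/(K + (xg)) → A/(K + (x)) → 0`
(`finrank_quotient_sup_span_mul_le`), and additive along the exact colon sequence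
`0 → A/(K : x) —·x→ A/K → A/(K + (x)) → 0` (`finrank_quotient_eq_colon_add`, with `K : x = K.colon {x}`). These are the
bookkeeping identities behind every "colength drops under blowing up" argument
(Huneke–Swanson, *Integral Closure of Ideals, Rings, and Modules*, CUP 2006, §14.1 and Lemma 14.3.4,
where they are used with lengths; over a field-algebra with residue field `κ` the two counts agree).
Everything is PROVED; no definitions.

## References
* [HunekeSwanson2006] C. Huneke, I. Swanson, Integral Closure of Ideals, Rings, and Modules, CUP 2006, §14.1.
-/

noncomputable section

open Module

namespace Literature.RingTheory.Length

variable {κ : Type*} [Field κ] {A : Type*} [CommRing A] [Algebra κ A]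

/-- **Third isomorphism, counted over `κ`.** For ideals `I ≤ I'` with `A ⧸ I` finite over `κ`:
`dim (A ⧸ I') + dim (I'/I) = dim (A ⧸ I)`, where `I'/I` is the image of `I'` in `A ⧸ I`. [folklore] -/
theorem finrank_quotient_add_finrank_map {I I' : Ideal A} (h : I ≤ I') [Module.Finite κ (A ⧸ I)] :
    finrank κ (A ⧸ I') + finrank κ (Submodule.map (Submodule.mkQ I) I') =
      finrank κ (A ⧸ I) := by
  have e : ((A ⧸ I) ⧸ (Submodule.map (Submodule.mkQ I) I')) ≃ₗ[A] (A ⧸ I') :=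
    Submodule.quotientQuotientEquivQuotient I I' h
  have h1 : finrank κ (A ⧸ I') = finrank κ ((A ⧸ I) ⧸ (Submodule.map (Submodule.mkQ I) I')) :=
    (e.restrictScalars κ).symm.finrank_eq
  have h2 := Submodule.finrank_quotient_add_finrank ((Submodule.map (Submodule.mkQ I) I').restrictScalars κ)
  have h3 : finrank κ ((A ⧸ I) ⧸ (Submodule.map (Submodule.mkQ I) I').restrictScalars κ) =
      finrank κ ((A ⧸ I) ⧸ (Submodule.map (Submodule.mkQ I) I')) :=
    (Submodule.Quotient.restrictScalarsEquiv κ (Submodule.map (Submodule.mkQ I) I')).finrank_eq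
  rw [h1, ← h3]
  exact h2

/-- **Colength is monotone**: `I ≤ I'` and `A ⧸ I` finite give `dim (A ⧸ I') ≤ dim (A ⧸ I)`. [folklore] -/
theorem finrank_quotient_le_of_le {I I' : Ideal A} (h : I ≤ I') [Module.Finite κ (A ⧸ I)] :
    finrank κ (A ⧸ I') ≤ finrank κ (A ⧸ I) := by
  have := finrank_quotient_add_finrank_map (κ := κ) h
  omega

/-- A quotient of a finite-colength ideal's quotient is finite: `I ≤ I'` and `A ⧸ I` finite over `κ`
give `A ⧸ I'` finite over `κ`. [folklore] -/
theorem finite_quotient_of_le {I I' : Ideal A} (h : I ≤ I') [Module.Finite κ (A ⧸ I)] :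
    Module.Finite κ (A ⧸ I') :=
  Module.Finite.of_surjective ((Ideal.Quotient.factorₐ κ h).toLinearMap)
    (Ideal.Quotient.factor_surjective h)

/-- **Colength is strictly monotone**: `I < I'` and `A ⧸ I` finite give `dim (A ⧸ I') < dim (A ⧸ I)`.
[folklore] -/
theorem finrank_quotient_lt_of_lt {I I' : Ideal A} (h : I < I') [Module.Finite κ (A ⧸ I)] :
    finrank κ (A ⧸ I') < finrank κ (A ⧸ I) := by
  have hsum := finrank_quotient_add_finrank_map (κ := κ) h.le
  -- the image of `I'` in `A ⧸ I` is non-zero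
  obtain ⟨a, haI', haI⟩ := Set.exists_of_ssubset h
  have hne : (Submodule.map (Submodule.mkQ I) I') ≠ ⊥ := by
    intro hbot
    have : Submodule.mkQ I a ∈ (Submodule.map (Submodule.mkQ I) I') :=
      Submodule.mem_map_of_mem haI'
    rw [hbot, Submodule.mem_bot, Submodule.mkQ_apply, Submodule.Quotient.mk_eq_zero] at this
    exact haI this
  haveI : Module.Finite κ (Submodule.map (Submodule.mkQ I) I') :=
    Module.Finite.of_injective ((Submodule.map (Submodule.mkQ I) I').subtype.restrictScalars κ)
      Subtype.val_injective
  have hpos : 0 < finrank κ (Submodule.map (Submodule.mkQ I) I') := by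
    rw [Module.finrank_pos_iff_exists_ne_zero]
    obtain ⟨v, hv, hv0⟩ := (Submodule.ne_bot_iff _).mp hne
    exact ⟨⟨v, hv⟩, fun h0 => hv0 (by simpa using congrArg Subtype.val h0)⟩
  omega

/-- **Sub-additivity along `A/(K + (g)) —·x→ A/(K + (x·g)) → A/(K + (x)) → 0`.** If
`A ⧸ (K + (x·g))` is finite over `κ` then
`dim A/(K + (x·g)) ≤ dim A/(K + (x)) + dim A/(K + (g))`. [folklore] -/
theorem finrank_quotient_sup_span_mul_le (K : Ideal A) (x g : A)
    [hfin : Module.Finite κ (A ⧸ (K ⊔ Ideal.span {x * g}))] :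
    finrank κ (A ⧸ (K ⊔ Ideal.span {x * g})) ≤
      finrank κ (A ⧸ (K ⊔ Ideal.span {x})) + finrank κ (A ⧸ (K ⊔ Ideal.span {g})) := by
  set L := K ⊔ Ideal.span {x * g} with hL
  have hLx : L ≤ K ⊔ Ideal.span {x} := by
    refine sup_le le_sup_left ?_
    rw [Ideal.span_singleton_le_iff_mem]
    exact Ideal.mem_sup_right (Ideal.mem_span_singleton'.mpr ⟨g, by ring⟩)
  have hLg : L ≤ K ⊔ Ideal.span {g} := by
    refine sup_le le_sup_left ?_
    rw [Ideal.span_singleton_le_iff_mem]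
    exact Ideal.mem_sup_right (Ideal.mem_span_singleton'.mpr ⟨x, by ring⟩)
  haveI : Module.Finite κ (A ⧸ (K ⊔ Ideal.span {g})) := finite_quotient_of_le (κ := κ) hLg
  -- `dim A/L = dim A/(K+(x)) + dim (image of (K+(x)) in A/L)`
  have hsum := finrank_quotient_add_finrank_map (κ := κ) hLx
  -- the image of `K + (x)` in `A/L` is the range of multiplication by `x` ...
  let μ : (A ⧸ (K ⊔ Ideal.span {g})) →ₗ[A] (A ⧸ L) :=
    Submodule.mapQ _ _ (LinearMap.mulLeft A x) (by
      intro a ha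
      change x * a ∈ L
      rcases Submodule.mem_sup.mp ha with ⟨k, hk, s, hs, rfl⟩
      rw [mul_add]
      refine Submodule.add_mem _ (Ideal.mem_sup_left (Ideal.mul_mem_left _ _ hk)) ?_
      obtain ⟨c, rfl⟩ := Ideal.mem_span_singleton'.mp hs
      exact Ideal.mem_sup_right (Ideal.mem_span_singleton'.mpr ⟨c, by ring⟩))
  have hrange : (Submodule.map (Submodule.mkQ L) (K ⊔ Ideal.span {x})) =
      LinearMap.range μ := by
    apply le_antisymm
    · rw [Submodule.map_le_iff_le_comap]
      intro a ha
      rcases Submodule.mem_sup.mp ha with ⟨k, hk, s, hs, rfl⟩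
      obtain ⟨c, rfl⟩ := Ideal.mem_span_singleton'.mp hs
      rw [Submodule.mem_comap, Submodule.mkQ_apply, Submodule.Quotient.mk_add]
      refine Submodule.add_mem _ ?_ ?_
      · have : (Submodule.Quotient.mk k : A ⧸ L) = 0 :=
          (Submodule.Quotient.mk_eq_zero L).mpr (Ideal.mem_sup_left hk)
        rw [this]; exact Submodule.zero_mem _
      · refine ⟨Submodule.Quotient.mk c, ?_⟩
        change Submodule.Quotient.mk (x * c) = Submodule.Quotient.mk (c * x)
        rw [mul_comm]
    · rintro _ ⟨q, rfl⟩
      induction q using Submodule.Quotient.induction_on with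
      | H a =>
        refine ⟨x * a, ?_, rfl⟩
        exact Ideal.mem_sup_right (Ideal.mem_span_singleton'.mpr ⟨a, by ring⟩)
  have hle : finrank κ (LinearMap.range μ) ≤ finrank κ (A ⧸ (K ⊔ Ideal.span {g})) :=
    LinearMap.finrank_range_le (μ.restrictScalars κ)
  have hcast : finrank κ (Submodule.map (Submodule.mkQ L) (K ⊔ Ideal.span {x})) =
      finrank κ (LinearMap.range μ) := by rw [hrange]
  omega

/-- **Additivity along the colon sequence `0 → A/(K : x) —·x→ A/K → A/(K + (x)) → 0`.** If `A ⧸ K`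
is finite over `κ` then `dim A/K = dim A/(K : x) + dim A/(K + (x))`. [folklore] -/
theorem finrank_quotient_eq_colon_add (K : Ideal A) (x : A) [Module.Finite κ (A ⧸ K)] :
    finrank κ (A ⧸ K) =
      finrank κ (A ⧸ K.colon {x}) + finrank κ (A ⧸ (K ⊔ Ideal.span {x})) := by
  -- `dim A/K = dim A/(K+(x)) + dim ((K+(x))/K)` and `(K+(x))/K ≅ A/(K : x)` via `a ↦ x a`
  have hsum := finrank_quotient_add_finrank_map (κ := κ) (le_sup_left : K ≤ K ⊔ Ideal.span {x})
  let μ : A →ₗ[A] (A ⧸ K) := (Submodule.mkQ K).comp (LinearMap.mulLeft A x)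
  have hker : LinearMap.ker μ = K.colon {x} := by
    ext a
    rw [LinearMap.mem_ker, Submodule.mem_colon_singleton]
    change Submodule.Quotient.mk (x * a) = 0 ↔ _
    rw [Submodule.Quotient.mk_eq_zero, smul_eq_mul, mul_comm]
  have hrange : LinearMap.range μ =
      (Submodule.map (Submodule.mkQ K) (K ⊔ Ideal.span {x})) := by
    apply le_antisymm
    · rintro _ ⟨a, rfl⟩
      exact ⟨x * a, Ideal.mem_sup_right (Ideal.mem_span_singleton'.mpr ⟨a, by ring⟩), rfl⟩
    · rw [Submodule.map_le_iff_le_comap]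
      intro a ha
      rcases Submodule.mem_sup.mp ha with ⟨k, hk, s, hs, rfl⟩
      obtain ⟨c, rfl⟩ := Ideal.mem_span_singleton'.mp hs
      rw [Submodule.mem_comap, Submodule.mkQ_apply, Submodule.Quotient.mk_add]
      refine Submodule.add_mem _ ?_ ⟨c, ?_⟩
      · have : (Submodule.Quotient.mk k : A ⧸ K) = 0 := (Submodule.Quotient.mk_eq_zero K).mpr hk
        rw [this]; exact Submodule.zero_mem _
      · change Submodule.Quotient.mk (x * c) = Submodule.Quotient.mk (c * x)
        rw [mul_comm]
  have e : (A ⧸ LinearMap.ker μ) ≃ₗ[A] LinearMap.range μ := μ.quotKerEquivRange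
  have h1 : finrank κ (A ⧸ K.colon {x}) = finrank κ (LinearMap.range μ) := by
    rw [← hker]; exact (e.restrictScalars κ).finrank_eq
  rw [h1, hrange]
  omega

end Literature.RingTheory.Length

end
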